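import Summits.KontsevichZagierPeriods.KontsevichZagierPeriods.Theses.PhiFourHepp
import Literature.NumberTheory.Transcendental.KZKernelConjectureForms

/-!
# Crux `PhiFourKernelH` (stmt-KontsevichZagierPeriods-12286, route `PhiFourHepp`) — birth skeleton (`Lines/birth.lean`, BC3)

Rank-0 TARGET crux of route `PhiFourHepp` (auto-crux since the 2026-08-16 backfill): the KERNEL FORM
OF THE ENLARGED CALCULUS `KZ^H` — `ker (KZ.eval) ⊆ closure (four move sets ∪ S_H)`, `S_H` = the Hepp
relator scheme (differences of `φ⁴` parametric representations `∫_{x>0} dx/Ψ_E(x,1)²` with equal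
inlined Hepp bound). Honest status recorded in the route: summit-strength given the bet
(`KernelOfSummitR`: summit ⇒ it; `closes : TropicalLifting → PhiFourKernelH → summit`).

This file cuts the crux along the two seams that separate its three logically distinct ingredients,
and proves the recomposition:

* `stub_kernelModCoincidences` (S1, transcendence content, GPC-strength RELATIVE to the `φ⁴`
  coincidences): Conjecture 1 in its `ℚ`-linear form, MODULO the sound relator scheme `S_P`
  (equal-PERIOD `φ⁴` pairs) — for literal-shape `r, r'` of equal value some `N • ([r] − [r'])`,
  `N ≥ 1`, lies in `kzP = closure (moves ∪ S_P)`;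
* `stub_torsionFreeModCoincidences` (S2, integrality, no transcendence content): `FormalRep ⧸ kzP`
  is torsion-free — division by an integer is a derived rule of the enlarged calculus;
* `stub_heppFaithfulForward` (S3, the printed combinatorial conjecture): Panzer 2022 Conj. 1.2,
  forward half `P(G₁) = P(G₂) ⇒ H(G₁) = H(G₂)`, in the crux's inlined coordinates — it is exactly
  what makes `S_P ⊆ S_H`.

`PhiFourKernelH_of_stubs : S1 → S2 → S3 → (ker eval ⊆ kzH)` is a real proof (soundness used twice, the
two bookkeeping facts of `KZCalculusProofs`, two monotonicities, one division); `PhiFourKernelH_of :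
PhiFourKernelH` feeds the three stubs in BY NAME (`kzH` is definitionally the crux's closure:
`phiFourKernelH_iff` is `Iff.rfl`). Sandwich: summit ⇒ S1, summit ⇒ S2, HeppFaithful(⇒) ⇒ S3, and
S1 ∧ S2 ⇔ `ker eval ⊆ kzP` (the kernel conjecture enlarged by the SOUND `φ⁴` coincidences), which with
S3 gives the crux. No stub is cheaply the crux or the summit — BC3 probes in the registrar's folder
(defs copied verbatim, NO stub / skeleton theorem in scope): `bc/probe_mustfail.lean`, for each stub
`Sᵢ → PhiFourKernelH` and `Sᵢ → KontsevichZagierPeriods` by `first | exact? | simpa | aesop` and by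
`exact?` alone — 12/12 FAIL (rc 1: 6 × "unsolved goals" after "aesop: failed to prove the goal after
exhaustive search", 6 × "`exact?` could not close the goal"); unfolding variant
`bc/probe_mustfail_unfold.lean` (`simpa [PhiFourKernelH, kzH, kzP, …] | (unfold …; simpa) | (unfold …;
aesop)`) — 6/6 FAIL (4 heartbeat time-outs at 400000, 2 unsolved `⊢ KZ.Equivalent r r'`); converses
`bc/probe_converse.lean` (`summit → Sᵢ`, `crux → Sᵢ`, informational) — 6/6 not found by the cheap
tactics either (S1, S2 ARE consequences of the summit by short real proofs: `N = 1` + monotonicity,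
resp. soundness); dedup `bc/probe_dedup.lean` (`example : Sᵢ := by intros; exact?`) — 3/3 FAIL.

Disproof used: none on record (`ledger crux ls stmt-KontsevichZagierPeriods-12286`: no workfiles —
no Disproof.lean, no Lines, no dead lines; negatives index of the summit: 1 entry,
`KinematicPlaneConvex` (stmt-5394, route KinematicFormulas) refuted by the empty body `L = ∅`,
unrelated — the stubs here are checked on degenerate data: `c = 0 ↦ N • 0 ∈ kzP`, `Ψ_E ≡ 0 ↦ value
0 = 0 ∧ flag sum 0 = 0`, divergent edge lists admit no `IntegralRep` (vacuous)).
-/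

noncomputable section

set_option linter.dupNamespace false

namespace Summit.KontsevichZagierPeriods.KontsevichZagierPeriods.Cruxes.PhiFourKernelH.Birth

open scoped BigOperators Topology Manifold Classical MeasureTheory ProbabilityTheory Matrix InnerProductSpace ComplexConjugate ContinuousMap
open Filter Set Function TopologicalSpace MeasureTheory
open Literature Periods

/-! ### The vocabulary of the crux, named (literal bodies copied from the route decl) -/

/-- **The set of `φ⁴` parametric data** `phiFourData k E` in the crux's own typing: an edge list `E` with `2k+2` edges on `k+2`
vertices, every vertex of degree `≤ 4` (Panzer 2022 p. 4: "in `φ⁴`"), and a KZ representation `r` in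
dimension `2k+1` whose domain is the open orthant and whose integrand is `1/Ψ_E(x,1)²` in the
determinantal form `Ψ_E = det [[diag(x,1), B], [−Bᵀ, 0]]` (`B` the reduced incidence matrix) — the three
clauses are VERBATIM the conjuncts of the Hepp relator scheme `S_H` inlined in
`Theses.PhiFourHepp.PhiFourKernelH` / `TropicalLifting`. (Existence of such an `r` forces absolute
convergence, i.e. `E` connected primitive-divergent, or `Ψ_E ≡ 0` with value `0`.)
[cite: Panzer2022, §1 p. 4 and Prop. 3.2] [cite: Schnetz2010, §2.2] -/
def phiFourData (k : ℕ) (E : Fin (2*k+2) → Fin (k+2) × Fin (k+2)) :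
    Set (Literature.NumberTheory.Transcendental.KZ.IntegralRep (2*k+1)) :=
  {r | (∀ v, (Finset.univ.filter fun e => (E e).1 = v ∨ (E e).2 = v).card ≤ 4) ∧ r.domain = {x | ∀ j, 0 < x j} ∧ Set.EqOn r.integrand (fun x => 1 / ((Matrix.fromBlocks (Matrix.diagonal (Fin.snoc x (1:ℝ) : Fin (2*k+2) → ℝ)) (Matrix.of fun (e : Fin (2*k+2)) (j : Fin (k+1)) => ((if (E e).1 = j.succ then (1:ℝ) else 0) - (if (E e).2 = j.succ then (1:ℝ) else 0))) (-(Matrix.of fun (e : Fin (2*k+2)) (j : Fin (k+1)) => ((if (E e).1 = j.succ then (1:ℝ) else 0) - (if (E e).2 = j.succ then (1:ℝ) else 0))).transpose) (0 : Matrix (Fin (k+1)) (Fin (k+1)) ℝ)).det) ^ 2) r.domain}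

/-- **The inlined Hepp bound** `H(E) ∈ ℚ` (unit indices, `D = 4`): Panzer's bridgeless-flag formula
(Panzer 2022, Prop. 3.2) exactly as inlined in the crux — sum over flags `γ₁ ⊊ ⋯ ⊊ γ_(k+1) = E` of
bridgeless edge sets with `loops(γ_j) = j` (bridgelessness and loop numbers via `ℚ`-ranks of signed
incidence matrices) of `|γ₁|·Π|γ_(j+1)∖γ_j| / Π_(j<ℓ)(|γ_j| − 2j)`. VERBATIM the left-hand side of the
Hepp-equality conjunct of `S_H`. [cite: Panzer2022, Prop. 3.2] -/
def heppFlagSum (k : ℕ) (E : Fin (2*k+2) → Fin (k+2) × Fin (k+2)) : ℚ :=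
  (∑ c : Fin (k+1) → Finset (Fin (2*k+2)), if ((∀ i : Fin (k+1), (c i).Nonempty ∧ (∀ e ∈ c i, (Matrix.of fun (p : {p // p ∈ (c i).erase e}) (v : Fin (k+2)) => ((if (E p.1).1 = v then (1:ℚ) else 0) - (if (E p.1).2 = v then (1:ℚ) else 0))).rank = (Matrix.of fun (p : {p // p ∈ c i}) (v : Fin (k+2)) => ((if (E p.1).1 = v then (1:ℚ) else 0) - (if (E p.1).2 = v then (1:ℚ) else 0))).rank) ∧ (c i).card - (Matrix.of fun (p : {p // p ∈ c i}) (v : Fin (k+2)) => ((if (E p.1).1 = v then (1:ℚ) else 0) - (if (E p.1).2 = v then (1:ℚ) else 0))).rank = i.val + 1) ∧ (∀ i j : Fin (k+1), i < j → c i ⊂ c j) ∧ c (Fin.last k) = Finset.univ) then ((c 0).card : ℚ) * (∏ i : Fin k, (((c i.succ).card : ℚ) - ((c i.castSucc).card : ℚ))) / (∏ i : Fin k, (((c i.castSucc).card : ℚ) - 2 * ((i.val : ℚ) + 1))) else 0)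

/-- **The period-coincidence relator scheme `S_P`** (the SOUND shadow of `S_H`): differences
`[r₁] − [r₂]` of `φ⁴` parametric data with EQUAL VALUE (equal period). Every element evaluates to `0`
by construction, so `closure (moves ∪ S_P) ≤ ker eval` (soundness of the four moves,
`KZ.relations_le_ker_eval_holds`). [cite: KontsevichZagier2001, §1.2] [cite: Panzer2022, Conj. 1.2] -/
def periodRelators : Set Literature.NumberTheory.Transcendental.KZ.FormalRep :=
  {d | ∃ (k₁ k₂ : ℕ) (E₁ : Fin (2*k₁+2) → Fin (k₁+2) × Fin (k₁+2)) (E₂ : Fin (2*k₂+2) → Fin (k₂+2) × Fin (k₂+2)) (r₁ : Literature.NumberTheory.Transcendental.KZ.IntegralRep (2*k₁+1)) (r₂ : Literature.NumberTheory.Transcendental.KZ.IntegralRep (2*k₂+1)), r₁ ∈ phiFourData k₁ E₁ ∧ r₂ ∈ phiFourData k₂ E₂ ∧ r₁.value = r₂.value ∧ d = Literature.NumberTheory.Transcendental.KZ.of r₁ - Literature.NumberTheory.Transcendental.KZ.of r₂}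

/-- **`KZ^P`**: the subgroup generated by the four move sets and the period-coincidence relators
`S_P` — the calculus enlarged by "equal-period `φ⁴` graphs are interderivable". Sound:
`kzP ≤ ker eval`. [cite: KontsevichZagier2001, §1.2] -/
def kzP : AddSubgroup Literature.NumberTheory.Transcendental.KZ.FormalRep :=
  AddSubgroup.closure (Literature.NumberTheory.Transcendental.KZ.domainAddRel ∪ Literature.NumberTheory.Transcendental.KZ.integrandAddRel ∪ Literature.NumberTheory.Transcendental.KZ.changeOfVariablesRel ∪ Literature.NumberTheory.Transcendental.KZ.newtonLeibnizRel ∪ periodRelators)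

/-- **The Hepp relator scheme `S_H`** — VERBATIM the set-builder inlined in the crux
`Theses.PhiFourHepp.PhiFourKernelH` (pairs of `φ⁴` parametric data with EQUAL INLINED HEPP BOUND).
[cite: Panzer2022, Prop. 3.2 and Conj. 1.2] -/
def heppRelators : Set Literature.NumberTheory.Transcendental.KZ.FormalRep :=
  {d : Literature.NumberTheory.Transcendental.KZ.FormalRep | ∃ (k₁ k₂ : ℕ) (E₁ : Fin (2*k₁+2) → Fin (k₁+2) × Fin (k₁+2)) (E₂ : Fin (2*k₂+2) → Fin (k₂+2) × Fin (k₂+2)) (r₁ : Literature.NumberTheory.Transcendental.KZ.IntegralRep (2*k₁+1)) (r₂ : Literature.NumberTheory.Transcendental.KZ.IntegralRep (2*k₂+1)), (∀ v, (Finset.univ.filter fun e => (E₁ e).1 = v ∨ (E₁ e).2 = v).card ≤ 4) ∧ (∀ v, (Finset.univ.filter fun e => (E₂ e).1 = v ∨ (E₂ e).2 = v).card ≤ 4) ∧ r₁.domain = {x | ∀ j, 0 < x j} ∧ Set.EqOn r₁.integrand (fun x => 1 / ((Matrix.fromBlocks (Matrix.diagonal (Fin.snoc x (1:ℝ) : Fin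 (2*k₁+2) → ℝ)) (Matrix.of fun (e : Fin (2*k₁+2)) (j : Fin (k₁+1)) => ((if (E₁ e).1 = j.succ then (1:ℝ) else 0) - (if (E₁ e).2 = j.succ then (1:ℝ) else 0))) (-(Matrix.of fun (e : Fin (2*k₁+2)) (j : Fin (k₁+1)) => ((if (E₁ e).1 = j.succ then (1:ℝ) else 0) - (if (E₁ e).2 = j.succ then (1:ℝ) else 0))).transpose) (0 : Matrix (Fin (k₁+1)) (Fin (k₁+1)) ℝ)).det) ^ 2) r₁.domain ∧ r₂.domain = {x | ∀ j, 0 < x j} ∧ Set.EqOn r₂.integrand (fun x => 1 / ((Matrix.fromBlocks (Matrix.diagonal (Fin.snoc x (1:ℝ) : Fin (2*k₂+2) → ℝ)) (Matrix.of fun (e : Fin (2*k₂+2)) (j : Fin (k₂+1)) => ((if (E₂ e).1 = j.succ then (1:ℝ) else 0) - (if (E₂ e).2 = j.succ then (1:ℝ) else 0))) (-(Matrix.of fun (e : Fin (2*k₂+2)) (j : Fin (k₂+1)) => ((if (E₂ e).1 = j.succ then (1:ℝ) else 0) - (if (E₂ e).2 = j.succ then (1:ℝ) else 0))).transpose) (0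 : Matrix (Fin (k₂+1)) (Fin (k₂+1)) ℝ)).det) ^ 2) r₂.domain ∧ (∑ c : Fin (k₁+1) → Finset (Fin (2*k₁+2)), if ((∀ i : Fin (k₁+1), (c i).Nonempty ∧ (∀ e ∈ c i, (Matrix.of fun (p : {p // p ∈ (c i).erase e}) (v : Fin (k₁+2)) => ((if (E₁ p.1).1 = v then (1:ℚ) else 0) - (if (E₁ p.1).2 = v then (1:ℚ) else 0))).rank = (Matrix.of fun (p : {p // p ∈ c i}) (v : Fin (k₁+2)) => ((if (E₁ p.1).1 = v then (1:ℚ) else 0) - (if (E₁ p.1).2 = v then (1:ℚ) else 0))).rank) ∧ (c i).card - (Matrix.of fun (p : {p // p ∈ c i}) (v : Fin (k₁+2)) => ((if (E₁ p.1).1 = v then (1:ℚ) else 0) - (if (E₁ p.1).2 = v then (1:ℚ) else 0))).rank = i.val + 1) ∧ (∀ i j : Fin (k₁+1), i < j → c i ⊂ c j) ∧ c (Fin.last k₁) = Finset.univ) then ((c 0).card : ℚ) * (∏ i : Fin k₁, (((c i.succ).card : ℚ) - ((c i.castSucc).card : ℚ))) / (∏ i : Fin k₁, (((c i.castSucc).card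 : ℚ) - 2 * ((i.val : ℚ) + 1))) else 0) = (∑ c : Fin (k₂+1) → Finset (Fin (2*k₂+2)), if ((∀ i : Fin (k₂+1), (c i).Nonempty ∧ (∀ e ∈ c i, (Matrix.of fun (p : {p // p ∈ (c i).erase e}) (v : Fin (k₂+2)) => ((if (E₂ p.1).1 = v then (1:ℚ) else 0) - (if (E₂ p.1).2 = v then (1:ℚ) else 0))).rank = (Matrix.of fun (p : {p // p ∈ c i}) (v : Fin (k₂+2)) => ((if (E₂ p.1).1 = v then (1:ℚ) else 0) - (if (E₂ p.1).2 = v then (1:ℚ) else 0))).rank) ∧ (c i).card - (Matrix.of fun (p : {p // p ∈ c i}) (v : Fin (k₂+2)) => ((if (E₂ p.1).1 = v then (1:ℚ) else 0) - (if (E₂ p.1).2 = v then (1:ℚ) else 0))).rank = i.val + 1) ∧ (∀ i j : Fin (k₂+1), i < j → c i ⊂ c j) ∧ c (Fin.last k₂) = Finset.univ) then ((c 0).card : ℚ) * (∏ i : Fin k₂, (((c i.succ).card : ℚ) - ((c i.castSucc).card : ℚ))) / (∏ i : Fin k₂, (((c i.castSucc).card : ℚ) - 2 * ((i.val : ℚ)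 + 1))) else 0) ∧ d = Literature.NumberTheory.Transcendental.KZ.of r₁ - Literature.NumberTheory.Transcendental.KZ.of r₂}

/-- **`KZ^H`**: the subgroup generated by the four move sets and `S_H` — definitionally the closure
on the right-hand side of the crux (`phiFourKernelH_iff` is `Iff.rfl`). [cite: Panzer2022, Conj. 1.2] [cite: KontsevichZagier2001, §1.2] -/
def kzH : AddSubgroup Literature.NumberTheory.Transcendental.KZ.FormalRep :=
  AddSubgroup.closure (Literature.NumberTheory.Transcendental.KZ.domainAddRel ∪ Literature.NumberTheory.Transcendental.KZ.integrandAddRel ∪ Literature.NumberTheory.Transcendental.KZ.changeOfVariablesRel ∪ Literature.NumberTheory.Transcendental.KZ.newtonLeibnizRel ∪ heppRelators)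

/-- Unfolding lemma: membership in `phiFourData k E` is the conjunction of the three literal clauses
(degrees `≤ 4`, orthant domain, determinantal integrand). [folklore] -/
theorem mem_phiFourData_iff (k : ℕ) (E : Fin (2*k+2) → Fin (k+2) × Fin (k+2))
    (r : Literature.NumberTheory.Transcendental.KZ.IntegralRep (2*k+1)) :
    r ∈ phiFourData k E ↔ ((∀ v, (Finset.univ.filter fun e => (E e).1 = v ∨ (E e).2 = v).card ≤ 4) ∧ r.domain = {x | ∀ j, 0 < x j} ∧ Set.EqOn r.integrand (fun x => 1 / ((Matrix.fromBlocks (Matrix.diagonal (Fin.snoc x (1:ℝ) : Fin (2*k+2) → ℝ)) (Matrix.of fun (e : Fin (2*k+2)) (j : Fin (k+1)) => ((if (E e).1 = j.succ then (1:ℝ) else 0) - (if (E e).2 = j.succ then (1:ℝ) else 0))) (-(Matrix.of fun (e : Fin (2*k+2)) (j : Fin (k+1)) => ((if (E e).1 = j.succ then (1:ℝ) else 0) - (if (E e).2 = j.succ then (1:ℝ) else 0))).transpose) (0 : Matrix (Fin (k+1)) (Fin (k+1)) ℝ)).det) ^ 2) r.domain) :=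
  Iff.rfl

/-- The crux, read through the named vocabulary: `PhiFourKernelH ↔ ker eval ⊆ kzH` — definitional
(`Iff.rfl`), which certifies that `heppRelators`/`kzH` are literally the crux's bodies. [cite: KontsevichZagier2001, §1.2 Conjecture 1] -/
theorem phiFourKernelH_iff :
    Summit.KontsevichZagierPeriods.KontsevichZagierPeriods.Theses.PhiFourHepp.PhiFourKernelH ↔
      ∀ c : Literature.NumberTheory.Transcendental.KZ.FormalRep, Literature.NumberTheory.Transcendental.KZ.eval c = 0 → c ∈ kzH :=
  Iff.rfl

/-! ### Registered stubs (the only `sorry`s of this file) -/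

/-- **STUB S1 (conjecture-grade; the transcendence-bearing piece) — Conjecture 1 MODULO THE `φ⁴`
PERIOD COINCIDENCES, UP TO TORSION.** For two representations of KZ's literal (rational) shape with
the same value, some non-zero integer multiple of `[r] − [r']` lies in `KZ^P` = the subgroup generated
by the four moves and the period-coincidence relators `S_P` (differences of equal-period `φ⁴`
parametric data). This is the `ℚ`-LINEAR shadow of the crux with the Hepp scheme replaced by its
sound, value-defined envelope: exactly the shape in which every motivic technology speaks
(Nori/André/Ayoub formal period ALGEBRAS are `ℚ`-vector spaces, Huber–Müller-Stach 2017 §13.2;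
"no division by integers is a rule" is the integral reading fixed in the Statement's docstring) and
with the `φ⁴` coincidences available as axioms. Honest status: the summit implies it (`N = 1`,
`KZ.relations ≤ kzP`); it is GPC-strength RELATIVE to `S_P` — false iff some vanishing `ℤ`-combination
stays underivable after adjoining every equal-period `φ⁴` pair and allowing an integer multiple
(route Neg's candidates: regularised MZV relations, Gauss-multiplication pairs, `π`-padding gaps).
Size: conjecture. [cite: KontsevichZagier2001, §1.2 Conjecture 1] [cite: HuberMullerStach2017, §13.2]
[cite: Panzer2022, Conj. 1.2] -/
theorem stub_kernelModCoincidences :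
    ∀ ⦃n m : ℕ⦄ (r : Literature.NumberTheory.Transcendental.KZ.IntegralRep n) (r' : Literature.NumberTheory.Transcendental.KZ.IntegralRep m),
      r.IsRational → r'.IsRational → r.value = r'.value →
        ∃ N : ℕ, N ≠ 0 ∧ N • (Literature.NumberTheory.Transcendental.KZ.of r - Literature.NumberTheory.Transcendental.KZ.of r') ∈ kzP := by
  sorry

/-- **STUB S2 (structural; integrality of the enlarged calculus) — `FormalRep ⧸ KZ^P` IS
TORSION-FREE:** if `N • c` (`N ≥ 1`) is derivable by moves and period-coincidence relators, so is
`c` ("division by an integer is an admissible derived rule of `KZ^P`"). Implied by Conjecture 1 alone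
(`kzP ≤ ker eval` by soundness, `eval (N • c) = N · eval c`, and `KZ.relations ≤ kzP`), but a
statement about the move group with NO transcendence content: the analogue, for KZ's rules
(1)–(3), of the divisibility questions for scissors-congruence groups (Jessen–Thorup, Sah,
Dupont–Sah). Attack: halving / `N`-section of domains by rational hyperplanes (rule 1a) + rational
translations and dilations (rule 2) realise `N • [r] ≡ [r ⊔ … ⊔ r]`; the open point is to descend a
derivation of the `N`-fold sums to one of the summands. Why it might fail: a genuine torsion class in `FormalRep ⧸ KZ^P`
(e.g. an orientation/antipodal `2`-torsion phenomenon) — which would refute Conjecture 1 outright.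
Size: M–L. [cite: KontsevichZagier2001, §1.2 rules (1)–(3)] [cite: HuberMullerStach2017, §13.1] -/
theorem stub_torsionFreeModCoincidences :
    ∀ (N : ℕ) (c : Literature.NumberTheory.Transcendental.KZ.FormalRep), N ≠ 0 → N • c ∈ kzP → c ∈ kzP := by
  sorry

/-- **STUB S3 (combinatorial–numerical conjecture in print) — HEPP FAITHFULNESS, FORWARD HALF, in
the crux's coordinates:** two `φ⁴` parametric data with equal value (equal period) have equal inlined
Hepp bounds — Panzer 2022 Conj. 1.2, direction `P(G₁) = P(G₂) ⇒ H(G₁) = H(G₂)` ("we expect that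
`P(G₁) = P(G₂)` implies `H(G₁) = H(G₂)`", Panzer–Yeats 2025 fn. 23), i.e. the `⇒` half of
`Literature.MathematicalPhysics.QuantumFieldTheory.HeppFaithful` transported to the inlined
determinantal integrand and flag formula (bridges: `kirchhoffEval_eq_det`, Panzer 2022 Prop. 3.2 =
fact `Panzer2022_prop_3_2`, convergence ⇔ primitive-divergent, Schnetz 2010 Prop. 6). Degenerate
typed instances are harmless: `Ψ_E ≡ 0` (disconnected) gives integrand `1/0² = 0`, value `0` and flag
sum `0` on both sides; divergent `E` admit no `IntegralRep` (vacuous); a convergent `E` has value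
`> 0`. It makes `S_P ⊆ S_H`, whence `kzP ≤ kzH`. Evidence: Panzer 2022 states Conj. 1.2 (both
directions) as consistent with every known `φ⁴` period (`ℓ ≤ 11`, > 1000 exact periods; §1 p. 4,
§5.2), and the five period symmetries (product, duality, completion, twist, Fourier split) preserve
`H` (Thm. 1.1), so every EXPLAINED period coincidence already has equal Hepp bounds — a counterexample
needs an unexplained exact coincidence with different Hepp bounds. Why it might fail: one pair of
`φ⁴` graphs with provably equal periods (e.g. by a new five-twist-type identity, Schnetz 2025) and
different Hepp bounds. Size: open conjecture (each instance decidable: `H` is a finite flag sum).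
[cite: Panzer2022, Conj. 1.2] [cite: PanzerYeats2025, §7.1 fn. 23] [cite: Schnetz2025, p. 8] -/
theorem stub_heppFaithfulForward :
    ∀ (k₁ k₂ : ℕ) (E₁ : Fin (2*k₁+2) → Fin (k₁+2) × Fin (k₁+2))
      (E₂ : Fin (2*k₂+2) → Fin (k₂+2) × Fin (k₂+2))
      (r₁ : Literature.NumberTheory.Transcendental.KZ.IntegralRep (2*k₁+1)) (r₂ : Literature.NumberTheory.Transcendental.KZ.IntegralRep (2*k₂+1)),
      r₁ ∈ phiFourData k₁ E₁ → r₂ ∈ phiFourData k₂ E₂ → r₁.value = r₂.value →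
        heppFlagSum k₁ E₁ = heppFlagSum k₂ E₂ := by
  sorry

/-! ### Composition (no `sorry` below this line) -/

/-- **Decomposition theorem (real proof; hypotheses = the three stub statements).** `S3` gives
`S_P ⊆ S_H`, hence `kzP ≤ kzH`; given `c` with `eval c = 0`, the bookkeeping facts of the calculus
(`KZ.exists_integralRep_sub_holds`: `c ≡ [r] − [r']` modulo moves; `KZ.exists_isRational_equivalent_holds`:
`r ~ R`, `r' ~ R'` of literal shape) and soundness (`KZ.relations_le_ker_eval_holds`,
`KZ.Equivalent.value_eq_holds`) give `R.value = R'.value`; `S1` puts `N • ([R] − [R'])` in `kzP`,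
so `N • c ∈ kzP` (`KZ.relations ≤ kzP`); `S2` divides by `N`; monotonicity lands `c` in `kzH`.
[cite: KontsevichZagier2001, §1.2 Conjecture 1] -/
theorem PhiFourKernelH_of_stubs
    (h₁ : ∀ ⦃n m : ℕ⦄ (r : Literature.NumberTheory.Transcendental.KZ.IntegralRep n) (r' : Literature.NumberTheory.Transcendental.KZ.IntegralRep m),
      r.IsRational → r'.IsRational → r.value = r'.value →
        ∃ N : ℕ, N ≠ 0 ∧ N • (Literature.NumberTheory.Transcendental.KZ.of r - Literature.NumberTheory.Transcendental.KZ.of r') ∈ kzP)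
    (h₂ : ∀ (N : ℕ) (c : Literature.NumberTheory.Transcendental.KZ.FormalRep), N ≠ 0 → N • c ∈ kzP → c ∈ kzP)
    (h₃ : ∀ (k₁ k₂ : ℕ) (E₁ : Fin (2*k₁+2) → Fin (k₁+2) × Fin (k₁+2))
      (E₂ : Fin (2*k₂+2) → Fin (k₂+2) × Fin (k₂+2))
      (r₁ : Literature.NumberTheory.Transcendental.KZ.IntegralRep (2*k₁+1)) (r₂ : Literature.NumberTheory.Transcendental.KZ.IntegralRep (2*k₂+1)),
      r₁ ∈ phiFourData k₁ E₁ → r₂ ∈ phiFourData k₂ E₂ → r₁.value = r₂.value →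
        heppFlagSum k₁ E₁ = heppFlagSum k₂ E₂) :
    ∀ c : Literature.NumberTheory.Transcendental.KZ.FormalRep, Literature.NumberTheory.Transcendental.KZ.eval c = 0 → c ∈ kzH := by
  -- the two monotonicities
  have hRP : Literature.NumberTheory.Transcendental.KZ.relations ≤ kzP :=
    AddSubgroup.closure_mono Set.subset_union_left
  have hPH : kzP ≤ kzH := by
    refine AddSubgroup.closure_mono (Set.union_subset_union_right _ ?_)
    rintro d ⟨k₁, k₂, E₁, E₂, r₁, r₂, hE₁, hE₂, hv, rfl⟩
    obtain ⟨hd₁, hdom₁, hint₁⟩ := (mem_phiFourData_iff k₁ E₁ r₁).1 hE₁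
    obtain ⟨hd₂, hdom₂, hint₂⟩ := (mem_phiFourData_iff k₂ E₂ r₂).1 hE₂
    exact ⟨k₁, k₂, E₁, E₂, r₁, r₂, hd₁, hd₂, hdom₁, hint₁, hdom₂, hint₂,
      h₃ k₁ k₂ E₁ E₂ r₁ r₂ hE₁ hE₂ hv, rfl⟩
  -- the kernel
  intro c hc
  obtain ⟨n, m, r, r', hrel⟩ := Literature.NumberTheory.Transcendental.KZ.exists_integralRep_sub_holds c
  obtain ⟨N₁, R, hR, hrR⟩ := Literature.NumberTheory.Transcendental.KZ.exists_isRational_equivalent_holds r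
  obtain ⟨N₂, R', hR', hrR'⟩ := Literature.NumberTheory.Transcendental.KZ.exists_isRational_equivalent_holds r'
  have hval : r.value = r'.value := by
    have h0 : Literature.NumberTheory.Transcendental.KZ.eval (c - (Literature.NumberTheory.Transcendental.KZ.of r - Literature.NumberTheory.Transcendental.KZ.of r')) = 0 :=
      Literature.NumberTheory.Transcendental.KZ.relations_le_ker_eval_holds hrel
    rw [map_sub, hc, zero_sub, neg_eq_zero, Literature.NumberTheory.Transcendental.KZ.eval_of_sub_of, sub_eq_zero] at h0
    exact h0
  have hvalR : R.value = R'.value := by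
    rw [← Literature.NumberTheory.Transcendental.KZ.Equivalent.value_eq_holds hrR, ← Literature.NumberTheory.Transcendental.KZ.Equivalent.value_eq_holds hrR', hval]
  obtain ⟨N, hN, hNR⟩ := h₁ R R' hR hR' hvalR
  have hsplit : Literature.NumberTheory.Transcendental.KZ.of r - Literature.NumberTheory.Transcendental.KZ.of r' =
      (Literature.NumberTheory.Transcendental.KZ.of r - Literature.NumberTheory.Transcendental.KZ.of R) + (Literature.NumberTheory.Transcendental.KZ.of R - Literature.NumberTheory.Transcendental.KZ.of R') + (Literature.NumberTheory.Transcendental.KZ.of R' - Literature.NumberTheory.Transcendental.KZ.of r') := by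
    abel
  have hNrr' : N • (Literature.NumberTheory.Transcendental.KZ.of r - Literature.NumberTheory.Transcendental.KZ.of r') ∈ kzP := by
    rw [hsplit, smul_add, smul_add]
    exact add_mem (add_mem (nsmul_mem (hRP hrR) N) hNR) (nsmul_mem (hRP hrR'.symm) N)
  have hNc : N • c ∈ kzP := by
    have hc' : N • c = N • (c - (Literature.NumberTheory.Transcendental.KZ.of r - Literature.NumberTheory.Transcendental.KZ.of r')) + N • (Literature.NumberTheory.Transcendental.KZ.of r - Literature.NumberTheory.Transcendental.KZ.of r') := by
      rw [← smul_add, sub_add_cancel]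
    rw [hc']
    exact add_mem (nsmul_mem (hRP hrel) N) hNrr'
  exact hPH (h₂ N c hN hNc)

/-- **The crux BY NAME from the three registered stubs** (the skeleton theorem audited by
`ledger skeleton check`; its only `sorryAx` dependencies are `stub_kernelModCoincidences`,
`stub_torsionFreeModCoincidences`, `stub_heppFaithfulForward`). [cite: KontsevichZagier2001, §1.2 Conjecture 1] -/
theorem PhiFourKernelH_of :
    Summit.KontsevichZagierPeriods.KontsevichZagierPeriods.Theses.PhiFourHepp.PhiFourKernelH :=
  phiFourKernelH_iff.mpr
    (PhiFourKernelH_of_stubs stub_kernelModCoincidences stub_torsionFreeModCoincidences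
      stub_heppFaithfulForward)

end Summit.KontsevichZagierPeriods.KontsevichZagierPeriods.Cruxes.PhiFourKernelH.Birth
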